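import Mathlib.Data.ZMod.Basic
import Mathlib.GroupTheory.OrderOfElement
import Mathlib.Algebra.Group.Subgroup.Finite
import Mathlib.Algebra.Order.BigOperators.Group.Finset
import HarnessLib

/-!
# Abelian `2`-groups with a marked involution: cyclic pieces, injective coproducts, descent and counting

COR-CM (cell `pub-hodgecm2`), binder seat b04 (gen 16), count-neutral claim ABELIAN-2POWER-NECESSITY, part IIIa.
KERNEL ONLY: theorems (pure group theory, Mathlib only); no definition, no named fact, no `sorry`.

Toolkit for part IIIb (the ATOM-EMBEDDING theorem: an abelian `2`-group with involution `c` which is not thin, not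
of order `≤ 8`, and not of order `16` with all doubles in `{0, c}`, contains one of the six atoms of part II through
`c`).  Everything is written ADDITIVELY for an abelian group `A` (applied to `Additive Gal(K/ℚ)` in part IV).

* §1 cyclic pieces `l_x : ℤ/n → A`, `p ↦ p·x` (`n·x = 0`; Mathlib `ZMod.lift`): `exists_zmodHom`.
* §2 injective coproducts: `coprod_injective_of_range` (`l ⊕ j` is injective if `j` is and `l(p) ∈ im j ⟹ p = 0`);
  the three piece lemmas — an involution `t ∉ im j` (`coprod_injective_two`), an element `v` with `4v = 0`,
  `2v ∉ im j` (`coprod_injective_four`), an element `w` with `8w = 0`, `4w ∉ im j` (`coprod_injective_eight`) — and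
  their first-piece versions.
* §3 ranges: `mem_range_coprod_two` (`x ∈ im(l_t ⊕ j) ↔ x ∈ im j ∨ x − t ∈ im j`), `mem_range_two`, and the
  involutions inside a cyclic piece: `eq_of_mem_range_four` (`{0, 2v}`), `eq_of_mem_range_eight` (`{0, 4w}`).
* §4 `2`-groups: descent `nsmul_eq_zero_of_descent` (no element of order `2^{k+1}` ⟹ exponent divides `2^k`),
  the fibre count `card_le_card_filter_mul_card_image` (`|A| ≤ |A[2]| · |2A|`), and `card_filter_two_nsmul_eq_pow`
  (`|A[2]|` is a power of `2`).

## References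

* [Dodson1984] B. Dodson, *The structure of Galois groups of CM-fields*, Trans. AMS 283 (1984), §3 (the
  `ρ`-structures `(G, ρ)` classified here for abelian `2`-groups).
-/

namespace Summit.HodgeConjecture.CorCM.TwoGroupPieces

variable {A : Type*} [AddCommGroup A]

/-! ## §1 Cyclic pieces -/

/-- The cyclic piece through `x`: if `n·x = 0` there is a homomorphism `ℤ/n → A`, `p ↦ p·x`. [folklore] -/
theorem exists_zmodHom (n : ℕ) [NeZero n] (x : A) (hx : n • x = 0) :
    ∃ l : ZMod n →+ A, ∀ p : ZMod n, l p = p.val • x := by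
  refine ⟨ZMod.lift n ⟨zmultiplesHom A x, ?_⟩, fun p => ?_⟩
  · change (n : ℤ) • x = 0
    rw [natCast_zsmul, hx]
  · conv_lhs => rw [← ZMod.natCast_zmod_val p]
    rw [show ((p.val : ℕ) : ZMod n) = ((p.val : ℤ) : ZMod n) by simp, ZMod.lift_coe]
    change ((p.val : ℕ) : ℤ) • x = p.val • x
    rw [natCast_zsmul]

/-! ## §2 Injective coproducts -/

section Coprod

variable {P M : Type*} [AddCommGroup P] [AddCommGroup M]

/-- `l ⊕ j : P × M → A` is injective when `j` is injective and `l(p) ∈ im j` forces `p = 0`. [folklore] -/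
theorem coprod_injective_of_range (l : P →+ A) (j : M →+ A) (hj : Function.Injective j)
    (h : ∀ p : P, l p ∈ j.range → p = 0) : Function.Injective (l.coprod j) := by
  rw [injective_iff_map_eq_zero]
  rintro ⟨p, m⟩ hpm
  rw [AddMonoidHom.coprod_apply] at hpm
  have hp : p = 0 := h p ⟨-m, by rw [map_neg, neg_eq_iff_add_eq_zero, add_comm]; exact hpm⟩
  subst hp
  rw [map_zero, zero_add] at hpm
  have hm : m = 0 := hj (by rw [hpm, map_zero])
  subst hm
  rfl

/-- The four elements of `ℤ/4`. [folklore] -/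
theorem zmod_four_cases : ∀ q : ZMod 4, q = 0 ∨ q = 1 ∨ q = 2 ∨ q = 3 := by decide

/-- The two elements of `ℤ/2`. [folklore] -/
theorem zmod_two_cases : ∀ q : ZMod 2, q = 0 ∨ q = 1 := by decide

/-- The eight elements of `ℤ/8`. [folklore] -/
theorem zmod_eight_cases : ∀ q : ZMod 8, q = 0 ∨ q = 1 ∨ q = 2 ∨ q = 3 ∨ q = 4 ∨ q = 5 ∨ q = 6 ∨ q = 7 := by
  decide

/-- **Order-`2` piece**: an involution `t` outside `im j` extends an injective `j` injectively. [folklore] -/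
theorem coprod_injective_two (l : ZMod 2 →+ A) {t : A} (hl : ∀ p : ZMod 2, l p = p.val • t) (j : M →+ A)
    (hj : Function.Injective j) (ht : t ∉ j.range) : Function.Injective (l.coprod j) :=
  coprod_injective_of_range l j hj fun p hp => by
    rcases zmod_two_cases p with rfl | rfl
    · rfl
    · rw [hl, show (1 : ZMod 2).val = 1 from rfl, one_smul] at hp
      exact absurd hp ht

/-- **Order-`4` piece**: `4v = 0` and `2v ∉ im j` (so `v, 3v ∉ im j` as well) extend an injective `j`
injectively by `p ↦ p·v`. [folklore] -/
theorem coprod_injective_four (l : ZMod 4 →+ A) {v : A} (hl : ∀ p : ZMod 4, l p = p.val • v) (hv4 : 4 • v = 0)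
    (j : M →+ A) (hj : Function.Injective j) (hv : 2 • v ∉ j.range) : Function.Injective (l.coprod j) :=
  coprod_injective_of_range l j hj fun p hp => by
    rcases zmod_four_cases p with rfl | rfl | rfl | rfl
    · rfl
    · rw [hl, show (1 : ZMod 4).val = 1 from rfl, one_smul] at hp
      exact absurd (by rw [two_nsmul]; exact add_mem hp hp) hv
    · rw [hl, show (2 : ZMod 4).val = 2 from rfl] at hp
      exact absurd hp hv
    · rw [hl, show (3 : ZMod 4).val = 3 from rfl] at hp
      have h6 : 3 • v + 3 • v = 2 • v := by
        rw [← add_nsmul, show (3 + 3 : ℕ) = 4 + 2 from rfl, add_nsmul, hv4, zero_add]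
      exact absurd (by rw [← h6]; exact add_mem hp hp) hv

/-- Reduction of multiples modulo `8` when `8w = 0`. [folklore] -/
theorem nsmul_eq_mod_eight {w : A} (hw8 : 8 • w = 0) (k : ℕ) : k • w = (k % 8) • w := by
  conv_lhs => rw [← Nat.div_add_mod k 8, add_nsmul, mul_nsmul, hw8, nsmul_zero, zero_add]

/-- **Order-`8` piece**: `8w = 0` and `4w ∉ im j` extend an injective `j` injectively by `p ↦ p·w` (every
non-zero multiple `p·w`, `p ∈ ℤ/8`, has a multiple equal to `4w`). [folklore] -/
theorem coprod_injective_eight (l : ZMod 8 →+ A) {w : A} (hl : ∀ p : ZMod 8, l p = p.val • w) (hw8 : 8 • w = 0)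
    (j : M →+ A) (hj : Function.Injective j) (hw : 4 • w ∉ j.range) : Function.Injective (l.coprod j) :=
  coprod_injective_of_range l j hj fun p hp => by
    rw [hl] at hp
    -- `k · (p·w) ∈ im j` for every `k`, and `k p ≡ 4 (mod 8)` is solvable for `p ≠ 0`
    have hk : ∀ k : ℕ, ((k * p.val) % 8) • w ∈ j.range := fun k => by
      rw [← nsmul_eq_mod_eight hw8, mul_nsmul']
      exact AddSubgroup.nsmul_mem _ hp k
    rcases zmod_eight_cases p with rfl | rfl | rfl | rfl | rfl | rfl | rfl | rfl
    · rfl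
    · exact absurd (by simpa [show (1 : ZMod 8).val = 1 from rfl] using hk 4) hw
    · exact absurd (by simpa [show (2 : ZMod 8).val = 2 from rfl] using hk 2) hw
    · exact absurd (by simpa [show (3 : ZMod 8).val = 3 from rfl] using hk 4) hw
    · exact absurd (by simpa [show (4 : ZMod 8).val = 4 from rfl] using hk 1) hw
    · exact absurd (by simpa [show (5 : ZMod 8).val = 5 from rfl] using hk 4) hw
    · exact absurd (by simpa [show (6 : ZMod 8).val = 6 from rfl] using hk 2) hw
    · exact absurd (by simpa [show (7 : ZMod 8).val = 7 from rfl] using hk 4) hw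

/-- First piece of order `2`: `p ↦ p·t` is injective on `ℤ/2` when `t ≠ 0`. [folklore] -/
theorem injective_two (l : ZMod 2 →+ A) {t : A} (hl : ∀ p : ZMod 2, l p = p.val • t) (ht : t ≠ 0) :
    Function.Injective l := by
  rw [injective_iff_map_eq_zero]
  intro p hp
  rcases zmod_two_cases p with rfl | rfl
  · rfl
  · rw [hl, show (1 : ZMod 2).val = 1 from rfl, one_smul] at hp
    exact absurd hp ht

/-- First piece of order `4`: `p ↦ p·v` is injective on `ℤ/4` when `4v = 0 ≠ 2v`. [folklore] -/
theorem injective_four (l : ZMod 4 →+ A) {v : A} (hl : ∀ p : ZMod 4, l p = p.val • v) (hv4 : 4 • v = 0)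
    (hv2 : 2 • v ≠ 0) : Function.Injective l := by
  rw [injective_iff_map_eq_zero]
  intro p hp
  rcases zmod_four_cases p with rfl | rfl | rfl | rfl
  · rfl
  · rw [hl, show (1 : ZMod 4).val = 1 from rfl, one_smul] at hp
    exact absurd (by rw [hp, nsmul_zero]) hv2
  · rw [hl, show (2 : ZMod 4).val = 2 from rfl] at hp
    exact absurd hp hv2
  · rw [hl, show (3 : ZMod 4).val = 3 from rfl] at hp
    have h6 : 3 • v + 3 • v = 2 • v := by
      rw [← add_nsmul, show (3 + 3 : ℕ) = 4 + 2 from rfl, add_nsmul, hv4, zero_add]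
    exact absurd (by rw [← h6, hp, add_zero]) hv2

/-- First piece of order `8`: `p ↦ p·w` is injective on `ℤ/8` when `8w = 0 ≠ 4w`. [folklore] -/
theorem injective_eight (l : ZMod 8 →+ A) {w : A} (hl : ∀ p : ZMod 8, l p = p.val • w) (hw8 : 8 • w = 0)
    (hw4 : 4 • w ≠ 0) : Function.Injective l := by
  rw [injective_iff_map_eq_zero]
  intro p hp
  rw [hl] at hp
  have hk : ∀ k : ℕ, ((k * p.val) % 8) • w = 0 := fun k => by
    rw [← nsmul_eq_mod_eight hw8, mul_nsmul', hp, nsmul_zero]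
  rcases zmod_eight_cases p with rfl | rfl | rfl | rfl | rfl | rfl | rfl | rfl
  · rfl
  · exact absurd (by simpa [show (1 : ZMod 8).val = 1 from rfl] using hk 4) hw4
  · exact absurd (by simpa [show (2 : ZMod 8).val = 2 from rfl] using hk 2) hw4
  · exact absurd (by simpa [show (3 : ZMod 8).val = 3 from rfl] using hk 4) hw4
  · exact absurd (by simpa [show (4 : ZMod 8).val = 4 from rfl] using hk 1) hw4
  · exact absurd (by simpa [show (5 : ZMod 8).val = 5 from rfl] using hk 4) hw4
  · exact absurd (by simpa [show (6 : ZMod 8).val = 6 from rfl] using hk 2) hw4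
  · exact absurd (by simpa [show (7 : ZMod 8).val = 7 from rfl] using hk 4) hw4

end Coprod

/-! ## §3 Ranges -/

section Range

variable {M : Type*} [AddCommGroup M]

/-- `im(l_t ⊕ j) = im j ∪ (t + im j)` for an involution piece `l_t`. [folklore] -/
theorem mem_range_coprod_two (l : ZMod 2 →+ A) {t : A} (hl : ∀ p : ZMod 2, l p = p.val • t) (j : M →+ A)
    (x : A) : x ∈ (l.coprod j).range ↔ x ∈ j.range ∨ x - t ∈ j.range := by
  constructor
  · rintro ⟨⟨p, m⟩, h⟩
    rw [AddMonoidHom.coprod_apply, hl] at h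
    rcases zmod_two_cases p with rfl | rfl
    · left
      exact ⟨m, by rw [← h, ZMod.val_zero, zero_smul, zero_add]⟩
    · right
      exact ⟨m, by rw [← h, show (1 : ZMod 2).val = 1 from rfl, one_smul, add_sub_cancel_left]⟩
  · rintro (⟨m, h⟩ | ⟨m, h⟩)
    · exact ⟨(0, m), by rw [AddMonoidHom.coprod_apply, hl, ZMod.val_zero, zero_smul, zero_add, h]⟩
    · exact ⟨(1, m), by
        rw [AddMonoidHom.coprod_apply, hl, h, show (1 : ZMod 2).val = 1 from rfl, one_smul, add_sub_cancel]⟩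

/-- `im l_t = {0, t}`. [folklore] -/
theorem mem_range_two (l : ZMod 2 →+ A) {t : A} (hl : ∀ p : ZMod 2, l p = p.val • t) (x : A) :
    x ∈ l.range ↔ x = 0 ∨ x = t := by
  constructor
  · rintro ⟨p, h⟩
    rw [hl] at h
    rcases zmod_two_cases p with rfl | rfl
    · left; rw [← h, ZMod.val_zero, zero_smul]
    · right; rw [← h, show (1 : ZMod 2).val = 1 from rfl, one_smul]
  · rintro (rfl | rfl)
    · exact ⟨0, by rw [map_zero]⟩
    · exact ⟨1, by rw [hl, show (1 : ZMod 2).val = 1 from rfl, one_smul]⟩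

/-- The involutions in `im l_v` (`4v = 0 ≠ 2v`) are `0` and `2v`. [folklore] -/
theorem eq_of_mem_range_four (l : ZMod 4 →+ A) {v : A} (hl : ∀ p : ZMod 4, l p = p.val • v) (hv4 : 4 • v = 0)
    (hv2 : 2 • v ≠ 0) {x : A} (hx : x ∈ l.range) (h2x : 2 • x = 0) : x = 0 ∨ x = 2 • v := by
  obtain ⟨p, rfl⟩ := hx
  rw [hl] at h2x ⊢
  have h6 : 3 • v + 3 • v = 2 • v := by
    rw [← add_nsmul, show (3 + 3 : ℕ) = 4 + 2 from rfl, add_nsmul, hv4, zero_add]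
  rcases zmod_four_cases p with rfl | rfl | rfl | rfl
  · left; rw [ZMod.val_zero, zero_smul]
  · rw [show (1 : ZMod 4).val = 1 from rfl, one_smul] at h2x; exact absurd h2x hv2
  · right; rfl
  · rw [show (3 : ZMod 4).val = 3 from rfl, two_nsmul, h6] at h2x; exact absurd h2x hv2

/-- The involutions in `im l_w` (`8w = 0 ≠ 4w`) are `0` and `4w`. [folklore] -/
theorem eq_of_mem_range_eight (l : ZMod 8 →+ A) {w : A} (hl : ∀ p : ZMod 8, l p = p.val • w) (hw8 : 8 • w = 0)
    (hw4 : 4 • w ≠ 0) {x : A} (hx : x ∈ l.range) (h2x : 2 • x = 0) : x = 0 ∨ x = 4 • w := by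
  obtain ⟨p, rfl⟩ := hx
  rw [hl] at h2x ⊢
  -- `2·(p·w) = 0` gives `(2k p mod 8)·w = 0` for all `k`
  have hk : ∀ k : ℕ, ((k * (2 * p.val)) % 8) • w = 0 := fun k => by
    rw [← nsmul_eq_mod_eight hw8, mul_nsmul', mul_nsmul', h2x, nsmul_zero]
  rcases zmod_eight_cases p with rfl | rfl | rfl | rfl | rfl | rfl | rfl | rfl
  · left; rw [ZMod.val_zero, zero_smul]
  · exact absurd (by simpa [show (1 : ZMod 8).val = 1 from rfl] using hk 2) hw4
  · exact absurd (by simpa [show (2 : ZMod 8).val = 2 from rfl] using hk 1) hw4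
  · exact absurd (by simpa [show (3 : ZMod 8).val = 3 from rfl] using hk 2) hw4
  · right; rfl
  · exact absurd (by simpa [show (5 : ZMod 8).val = 5 from rfl] using hk 2) hw4
  · exact absurd (by simpa [show (6 : ZMod 8).val = 6 from rfl] using hk 1) hw4
  · exact absurd (by simpa [show (7 : ZMod 8).val = 7 from rfl] using hk 2) hw4

end Range

/-! ## §4 Finite abelian `2`-groups: descent and counting -/

section TwoGroup

/-- **Descent**: if `2^N` kills `A` and no element has order exactly `2^{k+1}` (`2^{k+1} y = 0 ⟹ 2^k y = 0`),
then `2^k` kills `A`. [folklore] -/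
theorem nsmul_eq_zero_of_descent (N k : ℕ) (hN : ∀ x : A, 2 ^ N • x = 0)
    (h : ∀ y : A, 2 ^ (k + 1) • y = 0 → 2 ^ k • y = 0) : ∀ x : A, 2 ^ k • x = 0 := by
  -- `R m : 2^(k+m)` kills `A`; `R N` holds and `R (m+1) → R m`
  have hR : ∀ m : ℕ, (∀ x : A, 2 ^ (k + (m + 1)) • x = 0) → ∀ x : A, 2 ^ (k + m) • x = 0 := by
    intro m hm x
    have h1 : 2 ^ (k + 1) • (2 ^ m • x) = 0 := by
      rw [← mul_nsmul', ← pow_add, show k + 1 + m = k + (m + 1) by omega]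
      exact hm x
    have h2 := h _ h1
    rwa [← mul_nsmul', ← pow_add] at h2
  have hRN : ∀ x : A, 2 ^ (k + N) • x = 0 := fun x => by
    rw [pow_add, mul_nsmul', hN, nsmul_zero]
  have key : ∀ d : ℕ, ∀ x : A, 2 ^ (k + (N - d)) • x = 0 := by
    intro d
    induction d with
    | zero => simpa using hRN
    | succ d ih =>
      by_cases hd : d < N
      · have : N - d = N - (d + 1) + 1 := by omega
        rw [this] at ih
        exact hR _ ih
      · have : N - (d + 1) = N - d := by omega
        rw [this]
        exact ih
  simpa using key N

variable [Fintype A] [DecidableEq A]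

/-- **Fibre count**: `|A| ≤ |A[2]| · |2A|` (the fibres of doubling are cosets of the `2`-torsion). [folklore] -/
theorem card_le_card_filter_mul_card_image :
    Fintype.card A ≤ (Finset.univ.filter fun x : A => 2 • x = 0).card *
      (Finset.univ.image fun x : A => 2 • x).card := by
  rw [← Finset.card_univ]
  refine Finset.card_le_mul_card_image _ _ fun b hb => ?_
  obtain ⟨a₀, -, rfl⟩ := Finset.mem_image.1 hb
  refine Finset.card_le_card_of_injOn (fun a => a - a₀) (fun a ha => ?_) ?_
  · simp only [Finset.coe_filter, Finset.mem_univ, true_and, Set.mem_setOf_eq] at ha ⊢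
    rw [smul_sub, ha, sub_self]
  · intro a _ a' _ h
    exact sub_left_injective h

/-- `|A[2]|` is a power of `2` when `|A| = 2^{n+1}` (Lagrange). [folklore] -/
theorem card_filter_two_nsmul_eq_pow {n : ℕ} (hA : Fintype.card A = 2 ^ (n + 1)) :
    ∃ i : ℕ, i ≤ n + 1 ∧ (Finset.univ.filter fun x : A => 2 • x = 0).card = 2 ^ i := by
  -- the `2`-torsion subgroup
  let T : AddSubgroup A :=
    { carrier := {x | 2 • x = 0}
      add_mem' := fun {a b} ha hb => by
        simp only [Set.mem_setOf_eq] at ha hb ⊢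
        rw [smul_add, ha, hb, add_zero]
      zero_mem' := by simp
      neg_mem' := fun {a} ha => by
        simp only [Set.mem_setOf_eq] at ha ⊢
        rw [smul_neg, ha, neg_zero] }
  have hT : (Finset.univ.filter fun x : A => 2 • x = 0).card = Nat.card T := by
    rw [show Nat.card T = Nat.card {x : A // 2 • x = 0} from rfl, Nat.card_eq_fintype_card, Fintype.card_subtype]
  have hdvd : Nat.card T ∣ 2 ^ (n + 1) := by
    rw [← hA, ← Nat.card_eq_fintype_card]
    exact AddSubgroup.card_addSubgroup_dvd_card T
  obtain ⟨i, hi, h⟩ := (Nat.dvd_prime_pow Nat.prime_two).1 hdvd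
  exact ⟨i, hi, by rw [hT, h]⟩

/-- Small powers of `2`: `2^i ≤ 4`, `= 8`, or `≥ 16`. [folklore] -/
theorem two_pow_trichotomy (i : ℕ) : 2 ^ i ≤ 4 ∨ 2 ^ i = 8 ∨ 16 ≤ 2 ^ i := by
  rcases i with _ | _ | _ | _ | i
  · left; decide
  · left; decide
  · left; decide
  · right; left; decide
  · right; right
    calc (16 : ℕ) = 2 ^ 4 := by decide
      _ ≤ 2 ^ (i + 4) := Nat.pow_le_pow_right (by decide) (by omega)

end TwoGroup

end Summit.HodgeConjecture.CorCM.TwoGroupPieces
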